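import Mathlib
import Summits.KontsevichZagierPeriods.Zeta5Search.Families.DualConstantTermSum
import Summits.KontsevichZagierPeriods.Zeta5Search.WedgeDictionaryCorner
import HarnessLib

/-!
# ζ(5) search — Families: CONJECTURE D-exact holds at EVERY corner point of the dual lattice

HONEST FRAMING: systematic search; no irrationality claim unless certified.  Cell `pub-zeta5`, certifier 2
(cert-2 g7, 2026-08-21).  Identities between integers; no conjecture node is used; nothing about `ζ(5)`; no
number of record moves.

The corner points `a = aCorner n = (n,0,n,0,n,n,n,n)` (dual point `b(a) = (n; 0⁷)`; `WedgeDictionaryCorner`) are the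
bases of gen-1's pencil descent (`Elimination/PencilDescentSharp`, `DictPencilAxis`).  There Brown–Zudilin's leading
coefficient is `Q(a) = (−1)ⁿ` (`WedgeDictionary.QOf_aCorner`), and this file shows that P2 g6's dual constant term is
`1` as well, for every `n`: the numerator exponents are `A = (n,0,n,0,n,n,n,n)`, the gap exponents
`B = (n,0,n,n,n,0)`, and the coefficient of `g₀ⁿg₂ⁿg₃ⁿg₄ⁿ` in `(g₁+g₂)ⁿ(g₂+⋯+g₅)ⁿ(g₀+⋯+g₃)ⁿ(g₀+g₁+g₂)ⁿ` is `1`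
(extract `g₄`, `g₃`, `g₀`, `g₁` with `DualCT.coeff_X_add_pow_mul` of `Families/DualSpanProdCoeff`).  Together with
`Families/DualConstantTermSum` (six decided instances, the diagonal modulo one recurrence) and
`Families/DualConstantTermStar35` / `…Translations` (the first relations) this is the base of the propagation plan
`HOME/cert-2/g7/DEXACT-PLAN.md`.

* `numExp_aCorner`, `gapExp_aCorner` — the exponent data at the corner;
* **`dualConstantTerm_aCorner : dualConstantTerm (aCorner n) = 1`**;
* **`dexact_aCorner : |Q(aCorner n)| = dualConstantTerm (aCorner n)`** — an infinite family of instances of D-exact.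
-/

noncomputable section
open MvPolynomial Finset

namespace Summit.KontsevichZagierPeriods.Zeta5Search.Families.Cellular
open DualCT
open Summit.KontsevichZagierPeriods.Zeta5Search.WedgeDictionary (aCorner QOf_aCorner)
open Literature.NumberTheory.Irrationality

/-- Numerator exponents at the corner `a = (n,0,n,0,n,n,n,n)`: `A = (n,0,n,0,n,n,n,n)`. -/
theorem numExp_aCorner (n : ℕ) : numExp (aCorner n) = ![n, 0, n, 0, n, n, n, n] := by
  ext i; fin_cases i <;> simp [numExp, bzNum, aCorner]

/-- Gap exponents at the corner: `B = (n,0,n,n,n,0)`. -/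
theorem gapExp_aCorner (n : ℕ) : gapExp (aCorner n) = ![n, 0, n, n, n, 0] := by
  ext w
  fin_cases w <;> simp [gapExp, bzDen, aCorner, BrownZudilin2022.b24, BrownZudilin2022.b14,
    BrownZudilin2022.b57, BrownZudilin2022.b35]

/-- **The dual constant term at every corner point is `1`**: the coefficient of `g₀ⁿg₂ⁿg₃ⁿg₄ⁿ` in
`(g₁+g₂)ⁿ(g₂+⋯+g₅)ⁿ(g₀+⋯+g₃)ⁿ(g₀+g₁+g₂)ⁿ` (extract `g₄`, `g₃`, `g₀`, `g₁` in turn). -/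
theorem dualConstantTerm_aCorner (n : ℕ) : dualConstantTerm (aCorner n) = 1 := by
  rw [dualConstantTerm_eq_ctSum, ← coeff_dualSpanProd', numExp_aCorner, gapExp_aCorner]
  set m : Fin 6 →₀ ℕ := Finsupp.equivFunOnFinite.symm ![n, 0, n, n, n, 0] with hm
  have m0 : m 0 = n := by simp [hm]
  have m1 : m 1 = 0 := by simp [hm]
  have m2 : m 2 = n := by simp [hm]
  have m3 : m 3 = n := by simp [hm]
  have m4 : m 4 = n := by simp [hm]
  unfold dualSpanProd
  simp only [Matrix.cons_val_zero, Matrix.cons_val_one, Matrix.cons_val]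
  simp only [pow_zero, mul_one]
  -- goal: coeff m ((X 1 + X 2)^n * (X 2 + X 3 + X 4 + X 5)^n * (X 0 + X 1 + X 2 + X 3)^n * (X 0 + X 1 + X 2)^n) = 1
  rw [show ((X 1 + X 2) ^ n * (X 2 + X 3 + X 4 + X 5) ^ n * (X 0 + X 1 + X 2 + X 3) ^ n * (X 0 + X 1 + X 2) ^ n : P6)
      = (X 4 + (X 2 + X 3 + X 5)) ^ n * ((X 1 + X 2) ^ n * ((X 0 + X 1 + X 2 + X 3) ^ n * (X 0 + X 1 + X 2) ^ n))
      by ring]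
  rw [coeff_X_add_pow_mul (4 : Fin 6) ?_ ?_]
  rotate_left
  · repeat (first
      | with_reducible exact (notMem_vars_X_and (by decide)).1
      | with_reducible apply notMem_vars_mul
      | with_reducible refine (notMem_vars_pow_and ?_ _).1
      | with_reducible apply notMem_vars_add)
  · repeat (first
      | with_reducible exact (notMem_vars_X_and (by decide)).1
      | with_reducible apply notMem_vars_mul
      | with_reducible refine (notMem_vars_pow_and ?_ _).1
      | with_reducible apply notMem_vars_add)
  rw [m4, Nat.choose_self, Nat.sub_self, pow_zero, one_mul, Nat.cast_one, one_mul]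
  rw [show ((X 1 + X 2) ^ n * ((X 0 + X 1 + X 2 + X 3) ^ n * (X 0 + X 1 + X 2) ^ n) : P6)
      = (X 3 + (X 0 + X 1 + X 2)) ^ n * ((X 1 + X 2) ^ n * (X 0 + X 1 + X 2) ^ n) by ring]
  rw [coeff_X_add_pow_mul (3 : Fin 6) ?_ ?_]
  rotate_left
  · repeat (first
      | with_reducible exact (notMem_vars_X_and (by decide)).1
      | with_reducible apply notMem_vars_mul
      | with_reducible refine (notMem_vars_pow_and ?_ _).1
      | with_reducible apply notMem_vars_add)
  · repeat (first
      | with_reducible exact (notMem_vars_X_and (by decide)).1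
      | with_reducible apply notMem_vars_mul
      | with_reducible refine (notMem_vars_pow_and ?_ _).1
      | with_reducible apply notMem_vars_add)
  have m3' : (m.erase 4) 3 = n := by rw [Finsupp.erase_ne (by decide)]; exact m3
  rw [m3', Nat.choose_self, Nat.sub_self, pow_zero, one_mul, Nat.cast_one, one_mul]
  rw [show ((X 1 + X 2) ^ n * (X 0 + X 1 + X 2) ^ n : P6) = (X 0 + (X 1 + X 2)) ^ n * (X 1 + X 2) ^ n by ring]
  rw [coeff_X_add_pow_mul (0 : Fin 6) ?_ ?_]
  rotate_left
  · repeat (first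
      | with_reducible exact (notMem_vars_X_and (by decide)).1
      | with_reducible apply notMem_vars_mul
      | with_reducible refine (notMem_vars_pow_and ?_ _).1
      | with_reducible apply notMem_vars_add)
  · repeat (first
      | with_reducible exact (notMem_vars_X_and (by decide)).1
      | with_reducible apply notMem_vars_mul
      | with_reducible refine (notMem_vars_pow_and ?_ _).1
      | with_reducible apply notMem_vars_add)
  have m0' : ((m.erase 4).erase 3) 0 = n := by
    rw [Finsupp.erase_ne (by decide), Finsupp.erase_ne (by decide)]; exact m0
  rw [m0', Nat.choose_self, Nat.sub_self, pow_zero, one_mul, Nat.cast_one, one_mul]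
  rw [show ((X 1 + X 2) ^ n : P6) = (X 1 + X 2) ^ n * 1 by ring]
  rw [coeff_X_add_pow_mul (1 : Fin 6) ?_ ?_]
  rotate_left
  · exact (notMem_vars_X_and (by decide)).1
  · simp [MvPolynomial.vars_one]
  have m1' : (((m.erase 4).erase 3).erase 0) 1 = 0 := by
    rw [Finsupp.erase_ne (by decide), Finsupp.erase_ne (by decide), Finsupp.erase_ne (by decide)]; exact m1
  have idx : (((m.erase 4).erase 3).erase 0).erase 1 = Finsupp.single 2 n := by
    ext w; fin_cases w <;> simp [hm]
  rw [m1', Nat.choose_zero_right, Nat.sub_zero, Nat.cast_one, one_mul, idx, mul_one, coeff_X_pow_single, if_pos rfl]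

/-- **D-exact holds at every corner point** `a = (n,0,n,0,n,n,n,n)` (dual point `(n; 0⁷)`, the bases of gen-1's
pencil descent): `|Q(a)| = 1 = dualConstantTerm a` (`WedgeDictionary.QOf_aCorner`: `Q = (−1)ⁿ`). -/
theorem dexact_aCorner (n : ℕ) : |BrownZudilin2022.QOf (aCorner n)| = dualConstantTerm (aCorner n) := by
  rw [QOf_aCorner, dualConstantTerm_aCorner, abs_pow, abs_neg, abs_one, one_pow]

end Summit.KontsevichZagierPeriods.Zeta5Search.Families.Cellular
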